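import Literature.MathematicalPhysics.StatisticalMechanics.LennardJonesThermodynamicLimit
import Literature.MathematicalPhysics.StatisticalMechanics.StablePotentialsProofs
import Mathlib.Analysis.Subadditive
import HarnessLib

/-!
# Stability (9) and the thermodynamic limit (8) for Lennard-Jones — proofs

Topic `Literature/MathematicalPhysics/StatisticalMechanics`. DISCHARGES of the two named facts of
`LennardJonesThermodynamicLimit.lean`:

* `BlancLewin2015_9_holds : BlancLewin2015_9` — the ground-state form (9) of stability,
  `E(N) ≥ −C N` for the Lennard-Jones potential in every dimension `d ≤ 5`;
* `BlancLewin2015_8_holds : BlancLewin2015_8` — the thermodynamic limit (8): for `1 ≤ d ≤ 5`,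
  `e_∞ = lim E(N)/N` exists, `e_∞ ≤ E(N)/N` for all `N ≥ 1`, and `e_∞ < 0`.

Users of the facts feed `BlancLewin2015_9_holds` / `BlancLewin2015_8_holds` for
`(h : BlancLewin2015_9)` / `(h : BlancLewin2015_8)`.

## Source

X. Blanc, M. Lewin, *The crystallization conjecture: a review*, EMS Surv. Math. Sci. 2 (2015)
255–306 = arXiv:1504.01153, §1.2–§1.3 (arXiv pp. 5–6). Printed argument: "(9) `E(N) ≥ −CN` …
the converse assertion is actually true and it is sometimes called Fekete's subadditive lemma …
we even deduce `e_∞ = inf_{N ≥ 1} E(N)/N`"; subadditivity (4) `E(N+P) ≤ E(N) + E(P)` "is shown by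
sending `P` particles at infinity and using the fact that `V → 0`"; "`E(2) = min V`, hence
`E(2) < 0`" and (5) `E(N)/N ≤ (E(2)/2)(1 − 1/N) < 0`, so "`e_∞ < 0` from (5)"; and "The
Lennard-Jones potential (3) satisfies these conditions [(12)] in dimensions `d ≤ 5`, and it is
therefore stable."

## Proof architecture (what is reused)

* (9) from the configuration form (10) PROVED in `StablePotentialsProofs.lean`
  (`le_interactionEnergy_lennardJones`: `𝓔_N(x) ≥ −(2³²/12) N` for distinct points, `d ≤ 5`), by
  `le_ciInf` over the type of injective configurations; when that type is empty (`d = 0`,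
  `N ≥ 2`) the conditionally complete infimum is the junk value `0 ≥ −C N`
  (`Real.iInf_of_isEmpty`). Constant: `C = 2³²/12` in every `d ≤ 5`.
* (8): `N ↦ E(N)` is subadditive in every dimension `d ≥ 1`
  (`subadditive_groundStateEnergy_lennardJones`) — for `N, P ≥ 1` this is the strict binding
  inequality (6) `E(N+P) < E(N) + E(P)` of `LennardJonesClusters.lean`
  (`groundStateEnergy_add_lt`, "two groups of particles far away attract each other", exactly the
  printed translation argument) applied to ground states, which exist in every `d ≥ 1`
  (`exists_isGroundState_lennardJones`, strong induction on the tree's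
  `exists_isGroundState_lennardJones_of_lt`); `E(0) = E(1) = 0`. With the lower bound (9),
  Mathlib's Fekete lemma (`Subadditive.tendsto_lim`, `Subadditive.lim_le_div`) gives the limit
  `e_∞ = inf_{N ≥ 1} E(N)/N`, and `e_∞ ≤ E(2)/2 < 0` since `E(2) < 2 E(1) = 0`.
-/

noncomputable section

namespace Literature.MathematicalPhysics.StatisticalMechanics

open Filter Topology

/-! ### (9): the ground-state form of stability -/

/-- **`E(N) ≥ −(2³²/12) N` for Lennard-Jones in dimension `d ≤ 5`** (Blanc–Lewin 2015, (9), from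
the configuration form (10) `le_interactionEnergy_lennardJones`): the infimum over the type of
injective configurations inherits the bound (`le_ciInf`); if there is no injective configuration
(`d = 0`, `N ≥ 2`) the infimum is the junk value `0`. [cite: BlancLewin2015, §1.3 (9)–(10)] -/
theorem neg_mul_le_groundStateEnergy_lennardJones {d : ℕ} (hd : d ≤ 5) (N : ℕ) :
    -((65536 ^ 2 / 12 : ℝ) * (N : ℝ)) ≤ groundStateEnergy lennardJones d N := by
  unfold groundStateEnergy
  rcases isEmpty_or_nonempty
      {x : Fin N → EuclideanSpace ℝ (Fin d) // Function.Injective x} with h | h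
  · rw [Real.iInf_of_isEmpty]
    exact neg_nonpos.2 (by positivity)
  · exact le_ciInf fun x => le_interactionEnergy_lennardJones hd N x.1 x.2

/-- **Discharge of `BlancLewin2015_9`: stability of the Lennard-Jones potential, ground-state
form (9)** — in every dimension `d ≤ 5`, `E(N) ≥ −C N` for all `N`, with `C = 2³²/12`
(Blanc–Lewin 2015, §1.3: (9) ⟺ (10), and "The Lennard-Jones potential (3) satisfies these
conditions in dimensions `d ≤ 5`, and it is therefore stable"; the configuration form (10) is
`lennardJones_stable_holds`). [cite: BlancLewin2015, §1.3 (9), p. 6] -/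
theorem BlancLewin2015_9_holds : BlancLewin2015_9 := fun _ hd =>
  ⟨65536 ^ 2 / 12, neg_mul_le_groundStateEnergy_lennardJones hd⟩

/-! ### (8): the thermodynamic limit of `E(N)/N` -/

/-- **Lennard-Jones ground states exist in every dimension `d ≥ 1`** and for every `N`: strong
induction on `N` through the tree's induction step `exists_isGroundState_lennardJones_of_lt`
(Blanc–Lewin 2015, §1.2: strict binding (6) and its footnote; `LennardJonesGroundStatesExist_holds`
is the instance `d = 3`). [cite: BlancLewin2015, §1.2 (6)] -/
theorem exists_isGroundState_lennardJones {d : ℕ} (hd : 0 < d) (N : ℕ) :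
    ∃ x : Fin N → EuclideanSpace ℝ (Fin d), IsGroundState lennardJones x :=
  Nat.strong_induction_on N fun N ih => exists_isGroundState_lennardJones_of_lt hd N ih

/-- With at most one particle the ground-state energy vanishes: `E(0) = E(1) = 0` (no pair term;
the constant configuration is injective on a subsingleton). [folklore] -/
theorem groundStateEnergy_of_le_one (V : ℝ → ℝ) {d N : ℕ} (hN : N ≤ 1) :
    groundStateEnergy V d N = 0 := by
  haveI : Subsingleton (Fin N) := Fin.subsingleton_iff_le_one.2 hN
  haveI : Nonempty {x : Fin N → EuclideanSpace ℝ (Fin d) // Function.Injective x} :=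
    ⟨⟨fun _ => 0, Function.injective_of_subsingleton _⟩⟩
  unfold groundStateEnergy
  simp only [interactionEnergy_of_subsingleton, ciInf_const]

/-- **Subadditivity (4) of the Lennard-Jones ground-state energy**, `E(N+P) ≤ E(N) + E(P)`, in
every dimension `d ≥ 1` (Blanc–Lewin 2015, (4): "shown by sending `P` particles at infinity and
using the fact that `V → 0`"). For `N, P ≥ 1` this is the strict binding inequality (6)
`groundStateEnergy_add_lt` applied to ground states of the `N`- and `P`-particle problems
(`exists_isGroundState_lennardJones`); for `N = 0` or `P = 0` it is `E(0) = 0`.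
[cite: BlancLewin2015, §1.2 (4)] -/
theorem subadditive_groundStateEnergy_lennardJones {d : ℕ} (hd : 0 < d) :
    Subadditive fun N => groundStateEnergy lennardJones d N := by
  intro m n
  rcases Nat.eq_zero_or_pos m with rfl | hm
  · simp [groundStateEnergy_of_le_one lennardJones (zero_le_one : 0 ≤ 1)]
  rcases Nat.eq_zero_or_pos n with rfl | hn
  · simp [groundStateEnergy_of_le_one lennardJones (zero_le_one : 0 ≤ 1)]
  obtain ⟨y, hy⟩ := exists_isGroundState_lennardJones hd m
  obtain ⟨z, hz⟩ := exists_isGroundState_lennardJones hd n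
  exact (groundStateEnergy_add_lt hd hm hn hy hz).le

/-- `E(2) < 0` for Lennard-Jones in dimension `d ≥ 1` (Blanc–Lewin 2015, §1.2: "`E(2) = min V`,
hence `E(2) < 0`"); here from strict binding, `E(2) < E(1) + E(1) = 0`.
[cite: BlancLewin2015, §1.2] -/
theorem groundStateEnergy_lennardJones_two_neg {d : ℕ} (hd : 0 < d) :
    groundStateEnergy lennardJones d 2 < 0 := by
  obtain ⟨y, hy⟩ := exists_isGroundState_lennardJones hd 1
  have h := groundStateEnergy_add_lt hd one_pos one_pos hy hy
  rwa [groundStateEnergy_of_le_one lennardJones le_rfl, add_zero] at h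

/-- **Discharge of `BlancLewin2015_8`: the thermodynamic limit of the Lennard-Jones ground-state
energy per particle** (Blanc–Lewin 2015, §1.3 (8) with (4), (5), (9) and Fekete's subadditive
lemma): for `1 ≤ d ≤ 5`, `N ↦ E(N)` is subadditive (`subadditive_groundStateEnergy_lennardJones`)
and `E(N)/N ≥ −2³²/12` (`neg_mul_le_groundStateEnergy_lennardJones`), so by Fekete's lemma
(Mathlib `Subadditive.tendsto_lim`) `E(N)/N → e_∞ = inf_{N ≥ 1} E(N)/N`
(`Subadditive.lim_le_div`), and `e_∞ ≤ E(2)/2 < 0` (`groundStateEnergy_lennardJones_two_neg`).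
[cite: BlancLewin2015, §1.3 (8), pp. 5–6] -/
theorem BlancLewin2015_8_holds : BlancLewin2015_8 := by
  intro d hd1 hd5
  have hd : 0 < d := hd1
  have hsub : Subadditive fun N => groundStateEnergy lennardJones d N :=
    subadditive_groundStateEnergy_lennardJones hd
  have hbdd : BddBelow (Set.range fun n : ℕ => groundStateEnergy lennardJones d n / n) := by
    refine ⟨-(65536 ^ 2 / 12 : ℝ), ?_⟩
    rintro _ ⟨n, rfl⟩
    rcases Nat.eq_zero_or_pos n with rfl | hn
    · simp only [Nat.cast_zero, div_zero]
      exact neg_nonpos.2 (by positivity)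
    · have hn' : (0 : ℝ) < n := by exact_mod_cast hn
      rw [le_div_iff₀ hn', neg_mul]
      exact neg_mul_le_groundStateEnergy_lennardJones hd5 n
  refine ⟨hsub.lim, ?_, hsub.tendsto_lim hbdd, fun N hN => hsub.lim_le_div hbdd hN.ne'⟩
  calc hsub.lim ≤ groundStateEnergy lennardJones d 2 / (2 : ℕ) := hsub.lim_le_div hbdd two_ne_zero
    _ < 0 := div_neg_of_neg_of_pos (groundStateEnergy_lennardJones_two_neg hd) (by norm_num)

end Literature.MathematicalPhysics.StatisticalMechanics

end
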